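import Literature.Barriers.CriticalPhenomena.LaceExpansionPcSubcrit
import Literature.Probability.Percolation.SusceptibilityMeanFieldLower
import Mathlib.Analysis.Normed.Group.Tannery
import Mathlib.MeasureTheory.Integral.DominatedConvergence
import HarnessLib

/-!
# The passage `p ↑ p_c` in the lace expansion, proved: `Hara2008_prop12Pc` from the subcritical
# expansion and the left limit of `Π_p` (Hara 2008, Appendix A; Heydenreich–van der Hofstad, Cor. 8.13)

Barrier catalogue `Literature/Barriers/CriticalPhenomena/` (D-0021), companion of
`LaceExpansionPcSubcrit.lean` (the named facts `Hara2008_prop12Subcrit`, `Hara2008_piLeftLimit` and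
the structure `IsLaceCoefficientAt`) and of `LaceExpansionPcInputs.lean` (`Hara2008_prop12Pc`, the
`k`-space half of `Hara2008_laceExpansionPc`). Here

  `Hara2008_prop12Pc_of_subcrit : Hara2008_prop12Subcrit → Hara2008_piLeftLimit → Hara2008_prop12Pc`

is PROVED, i.e. items 1–4 of Hara's Appendix A ("We in this Appendix show how to extend these
results to `p = p_c`") — equivalently the "extension to `p = p_c`" in the proof of
Heydenreich–van der Hofstad's Cor. 8.13, (8.5.4)–(8.5.5) — for the objects of this library:

* the Fourier side of (6.1.2) below `p_c` (`τ_p ∈ ℓ¹` by sharpness): the convolution theorem for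
  `ℓ¹(ℤ^d)` (`latticeFT_tsum_mul_sub`), `τ̂_p = ĝ_p + Ĵ_p τ̂_p` and `τ̂_p = ĝ_p/(1 - Ĵ_p)` ((6.1.3)),
  `Ĵ_p(0) < 1` and `χ(p)(1 - Ĵ_p(0)) = ĝ_p(0)` (summing over `x`), `Re(1 - Ĵ_p(k)) > c₁|k|²/d` on the
  cube, Fourier inversion `(2π)^d τ_p(x) = ∫ e^{ikx} ĝ_p/(1 - Ĵ_p)`, the uniform majorant
  `‖ĝ_p/(1 - Ĵ_p)‖ ≤ B d/(c₁|k|²) ≤ const · S(k)^{-1}` ("the integrand is integrable in `k` uniformly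
  in `p < p_c`, thanks to the infrared bound"), and UNIQUENESS of the subcritical coefficient
  (`IsLaceCoefficientAt.unique`, Heydenreich–van der Hofstad Exercise 6.1);
* `∫_{[-π,π]^d} S^{-1} < ∞` for `d ≥ 7` (from the case `S^{-3}` of `InfraredTriangleAnalysis.lean`)
  and `S > 0` off the origin;
* the limits `p ↑ p_c`: `g_p → g`, `J_p → J` pointwise, `ĝ_p(k) → ĝ(k)`, `Ĵ_p(k) → Ĵ(k)` and
  `Ĵ_p(0) → Ĵ(0)` (Tannery's theorem with the `p`-independent majorant of Prop. 1.2), and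
  **(A.1) derived**: `Ĵ_p(0) → 1`, from `χ(p)(1 - Ĵ_p(0)) = ĝ_p(0)` and the mean-field bound
  `χ(p) ≥ 1/(2d(p_c - p))` (`AizenmanNewman1984_chi_lower_holds`);
* the assembly: symmetry, domination, the second moment (Fatou on finite sums), `Ĵ_{p_c}(0) = 1`,
  the infrared lower bound at `p_c`, and the representation
  `τ_{p_c}(x) = lim τ_p(x) = lim ∫ e^{ikx} ĝ_p/(1 - Ĵ_p) dk/(2π)^d = ∫ e^{ikx} ĝ/(1 - Ĵ) dk/(2π)^d`
  (left-continuity of `τ_p`, `tendsto_tau_nhdsLT_criticalProbI`, and dominated convergence on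
  the cube).

Consequence: `Hara2008_laceExpansionPc_of_subcrit` (with the `x`-space half). After this file and
`LaceExpansionXSpaceBootstrap.lean`, the barrier fact `Hara2008_etaZeroXSpace` rests on the named
facts `Hara2008_prop12Subcrit`, `Hara2008_piLeftLimit` (lace expansion below `p_c` and the left
limit of its coefficients), `Hara2008_lemma15Pc`, `Hara2008_lemma16Pc` (diagrammatic estimates),
`Hara2008_lemma17Pc` (fractional-derivative Fourier analysis) and `Hara2008_gaussianConvolution`
(the Gaussian lemma).

## References

* T. Hara, Ann. Probab. 36 (2008) 530–593 (arXiv:math-ph/0504021): Appendix A, items 1–4 ("the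
  integrand is integrable in `k` uniformly in `p < p_c`, thanks to the infrared bound (recall that
  we are considering `d > 2`)"; the display `G_{p_c}(x) = lim_{p↑p_c} G_p(x) = … =
  ∫ e^{ikx} ĝ_{p_c}(k)/(1 - Ĵ_{p_c}(k)) d^dk/(2π)^d`; (A.1)).
* M. Heydenreich, R. van der Hofstad, *Progress in High-Dimensional Percolation and Random
  Graphs*, Springer 2017: (6.1.2)–(6.1.3), Exercise 6.1, (6.1.6), (7.1.7)–(7.1.8), Cor. 8.13 and
  its proof ((8.5.4)–(8.5.5)).
* G. Grimmett, *Percolation*, 2nd ed., Springer 1999, (10.41) (`χ(p) ≥ 1/(2d(p_c - p))`).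
-/

noncomputable section

namespace Literature.Barriers.CriticalPhenomena

open _root_.MeasureTheory _root_.Filter _root_.Topology Literature.Probability.LatticeModels
  Literature.Probability.Percolation Literature.Barriers.CriticalPhenomena.Slade2006Prop53

open scoped ENNReal

variable {d : ℕ}

/-! ### The transform of a convolution of two `ℓ¹` functions -/

section Convolution

variable {a b : Site d → ℝ}

/-- The double family `(x, y) ↦ a(y) b(x - y)` is absolutely summable for `a, b ∈ ℓ¹`. [folklore] -/
theorem summable_abs_conv_pair (ha : Summable fun x => |a x|) (hb : Summable fun x => |b x|) :
    Summable fun xy : Site d × Site d => |a xy.2 * b (xy.1 - xy.2)| := by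
  have hprod : Summable fun yz : Site d × Site d => |a yz.1| * |b yz.2| :=
    ha.mul_of_nonneg hb (fun _ => abs_nonneg _) (fun _ => abs_nonneg _)
  -- transport along `(y, z) ↦ (y + z, y)`
  set e : Site d × Site d ≃ Site d × Site d :=
    { toFun := fun yz => (yz.1 + yz.2, yz.1)
      invFun := fun xy => (xy.2, xy.1 - xy.2)
      left_inv := fun yz => by simp
      right_inv := fun xy => by simp } with he
  have h2 : Summable fun xy : Site d × Site d => |a (e.symm xy).1| * |b (e.symm xy).2| :=
    (e.symm.summable_iff (f := fun yz : Site d × Site d => |a yz.1| * |b yz.2|)).2 hprod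
  refine h2.congr fun xy => ?_
  simp only [he, Equiv.coe_fn_symm_mk, abs_mul]

/-- The convolution `(a ⋆ b)(x) = Σ_y a(y) b(x - y)` of two `ℓ¹` functions is in `ℓ¹` (formerly
`summable_abs_conv` in this file; renamed so as not to clash with the different statement of that
name in `LaceExpansionFourierIdentity.lean`, making the two modules importable together). [folklore] -/
theorem summable_abs_tsum_mul_sub (ha : Summable fun x => |a x|) (hb : Summable fun x => |b x|) :
    Summable fun x : Site d => |∑' y, a y * b (x - y)| := by
  have hpair := summable_abs_conv_pair ha hb
  have h1 : Summable fun x : Site d => ∑' y, |a y * b (x - y)| := hpair.prod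
  refine Summable.of_nonneg_of_le (fun _ => abs_nonneg _) (fun x => ?_) h1
  have hx : Summable fun y => |a y * b (x - y)| := hpair.prod_factor x
  calc |∑' y, a y * b (x - y)| = ‖∑' y, a y * b (x - y)‖ := (Real.norm_eq_abs _).symm
    _ ≤ ∑' y, ‖a y * b (x - y)‖ := norm_tsum_le_tsum_norm (by simpa [Real.norm_eq_abs] using hx)
    _ = ∑' y, |a y * b (x - y)| := by simp [Real.norm_eq_abs]

/-- **Convolution theorem for `ℓ¹(ℤ^d)`**: `(a ⋆ b)^(k) = â(k) b̂(k)` (Cauchy product, regrouped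
along `x = y + z`; formerly `latticeFT_conv` in this file, renamed so as not to clash with the
different statement of that name in `LaceExpansionFourierIdentity.lean`). [folklore] -/
theorem latticeFT_tsum_mul_sub (ha : Summable fun x => |a x|) (hb : Summable fun x => |b x|)
    (k : Fin d → ℝ) :
    latticeFT (fun x => ∑' y, a y * b (x - y)) k = latticeFT a k * latticeFT b k := by
  set E : Site d → ℂ := fun y => Complex.exp (-(Complex.I * (kdot k y : ℂ))) with hE
  set F : Site d → ℂ := fun y => (a y : ℂ) * E y with hF
  set G : Site d → ℂ := fun z => (b z : ℂ) * E z with hG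
  have hEadd : ∀ y z : Site d, E (y + z) = E y * E z := by
    intro y z
    simp only [hE, kdot_add, Complex.ofReal_add, mul_add, neg_add, Complex.exp_add]
  have hFn : ∀ y, ‖F y‖ = |a y| := fun y => norm_latticeFT_term a k y
  have hGn : ∀ z, ‖G z‖ = |b z| := fun z => norm_latticeFT_term b k z
  have hFs : Summable fun y => ‖F y‖ := by simpa only [hFn] using ha
  have hGs : Summable fun z => ‖G z‖ := by simpa only [hGn] using hb
  -- Cauchy product
  have hprod : latticeFT a k * latticeFT b k = ∑' yz : Site d × Site d, F yz.1 * G yz.2 :=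
    tsum_mul_tsum_of_summable_norm hFs hGs
  have hFG : Summable fun yz : Site d × Site d => F yz.1 * G yz.2 :=
    summable_mul_of_summable_norm hFs hGs
  -- regroup along `x = y + z`
  set e : Site d × Site d ≃ Site d × Site d :=
    { toFun := fun yz => (yz.1 + yz.2, yz.1)
      invFun := fun xy => (xy.2, xy.1 - xy.2)
      left_inv := fun yz => by simp
      right_inv := fun xy => by simp } with he
  set H : Site d × Site d → ℂ := fun xy => F xy.2 * G (xy.1 - xy.2) with hH
  have hHe : ∀ yz, H (e yz) = F yz.1 * G yz.2 := by
    intro yz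
    simp only [hH, he, Equiv.coe_fn_mk, add_sub_cancel_left]
  have hHsum : Summable H := by
    have := (e.summable_iff (f := H)).2
    refine (e.summable_iff (f := H)).1 ?_
    exact hFG.congr fun yz => (hHe yz).symm
  have hreg : ∑' yz : Site d × Site d, F yz.1 * G yz.2 = ∑' xy, H xy := by
    rw [← e.tsum_eq H]
    exact tsum_congr fun yz => (hHe yz).symm
  rw [hprod, hreg, hHsum.tsum_prod]
  -- the inner sums
  unfold latticeFT
  refine tsum_congr fun x => ?_
  have hx : Summable fun y => a y * b (x - y) := by
    have := (summable_abs_conv_pair ha hb).prod_factor x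
    exact (summable_abs_iff.1 this)
  rw [Complex.ofReal_tsum, ← tsum_mul_right]
  refine tsum_congr fun y => ?_
  simp only [hH, hF, hG]
  have : E x = E y * E (x - y) := by rw [← hEadd, add_sub_cancel]
  change ((a y * b (x - y) : ℝ) : ℂ) * E x = _
  rw [this]
  push_cast
  ring

/-- The convolution written with real scalars has the expected total sum:
`Σ_x (a ⋆ b)(x) = (Σ a)(Σ b)` (the case `k = 0`). [folklore] -/
theorem tsum_conv (ha : Summable fun x => |a x|) (hb : Summable fun x => |b x|) :
    ∑' x, ∑' y, a y * b (x - y) = (∑' x, a x) * ∑' x, b x := by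
  have h := latticeFT_tsum_mul_sub ha hb 0
  have h0 : ∀ f : Site d → ℝ, latticeFT f 0 = ((∑' x, f x : ℝ) : ℂ) := by
    intro f
    unfold latticeFT
    rw [Complex.ofReal_tsum]
    refine tsum_congr fun x => ?_
    simp
  rw [h0, h0, h0] at h
  exact_mod_cast h

end Convolution

/-! ### Consequences of the subcritical expansion at a fixed `p < p_c` -/

section Subcrit

variable {p : unitInterval} {Φ : Site d → ℝ}

/-- Below `p_c` the two-point function is summable (`d ≥ 2`). [folklore] -/
theorem summable_abs_tau_of_lt (hd : 2 ≤ d) (hp : p < criticalProbI d) :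
    Summable fun x => |tau d p 0 x| :=
  (summable_tau_of_lt_criticalProb hd p hp).abs

/-- **The expansion in Fourier space below `p_c`**: `τ̂_p(k) = ĝ(k) + Ĵ(k) τ̂_p(k)`, the transform
of `τ_p = g + J ⋆ τ_p` ((6.1.2) ⟹ (6.1.3) before dividing).
[cite: HeydenreichVanDerHofstad2017, (6.1.2)–(6.1.3)] -/
theorem IsLaceCoefficientAt.latticeFT_tau_eq (h : IsLaceCoefficientAt d p Φ) (hd : 2 ≤ d)
    (hp : p < criticalProbI d) (k : Fin d → ℝ) :
    latticeFT (tau d p 0) k =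
      latticeFT (laceSource Φ) k + latticeFT (laceKernel p Φ) k * latticeFT (tau d p 0) k := by
  have hτ := summable_abs_tau_of_lt hd hp
  have hg := summable_abs_laceSource h.summable_abs
  have hJ := summable_abs_laceKernel h.summable_abs (p : ℝ)
  have hconv := summable_abs_tsum_mul_sub hJ hτ
  rw [← latticeFT_tsum_mul_sub hJ hτ k, ← latticeFT_add hg hconv k]
  unfold latticeFT
  refine tsum_congr fun x => ?_
  rw [h.conv x]

/-- **`Ĵ_p(0) < 1` below `p_c`**: summing the expansion over `x` gives `χ(p)(1 - Ĵ_p(0)) = ĝ_p(0)`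
with `χ(p) = Σ_x τ_p(0,x) ∈ [1, ∞)` and `Ĵ_p(0) = 2dp ĝ_p(0)`; `Ĵ_p(0) ≥ 1` would force
`ĝ_p(0) ≤ 0` and then `Ĵ_p(0) ≤ 0`. (Heydenreich–van der Hofstad (7.1.7)–(7.1.8): `μ_p =
2dp[1 + Π̂_p(0)]`, `μ_{p_c} = 1`.) [cite: HeydenreichVanDerHofstad2017, (6.1.3) at k = 0 and (7.1.7)–(7.1.8)] -/
theorem IsLaceCoefficientAt.tsum_laceKernel_lt_one (h : IsLaceCoefficientAt d p Φ) (hd : 2 ≤ d)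
    (hp : p < criticalProbI d) : ∑' y, laceKernel p Φ y < 1 := by
  have hτ := summable_abs_tau_of_lt hd hp
  have hg := summable_abs_laceSource h.summable_abs
  have hgs : Summable (laceSource Φ) := summable_abs_iff.1 hg
  have hJ := summable_abs_laceKernel h.summable_abs (p : ℝ)
  set s : ℝ := ∑' y, laceKernel p Φ y with hs
  set G0 : ℝ := ∑' x, laceSource Φ x with hG0
  set χ : ℝ := ∑' x, tau d p 0 x with hχ
  have hχ1 : 1 ≤ χ := one_le_chi hd p hp
  -- sum the identity over `x`
  have hsum : χ = G0 + s * χ := by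
    have e : ∀ x, tau d p 0 x = laceSource Φ x + ∑' y, laceKernel p Φ y * tau d p 0 (x - y) := h.conv
    have h1 : ∑' x, tau d p 0 x =
        ∑' x, (laceSource Φ x + ∑' y, laceKernel p Φ y * tau d p 0 (x - y)) := tsum_congr e
    rw [Summable.tsum_add hgs (summable_abs_iff.1 (summable_abs_tsum_mul_sub hJ hτ)), tsum_conv hJ hτ] at h1
    exact h1
  have hsJ : s = 2 * d * p * G0 := by rw [hs, hG0, tsum_laceKernel hgs]
  by_contra hle
  have hs1 : 1 ≤ s := not_lt.1 hle
  have hG0le : G0 ≤ 0 := by nlinarith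
  have hp0 : (0 : ℝ) ≤ p := p.2.1
  have hd0 : (0 : ℝ) ≤ d := Nat.cast_nonneg d
  have : s ≤ 0 := by
    rw [hsJ]
    have : 0 ≤ 2 * (d : ℝ) * p := by positivity
    exact mul_nonpos_of_nonneg_of_nonpos this hG0le
  linarith

/-- `Ĵ_p(0)` is the sum `Σ_y J(y)` (real). [folklore] -/
theorem re_latticeFT_zero {J : Site d → ℝ} (hJ : Summable fun x => |J x|) :
    (latticeFT J 0).re = ∑' y, J y := by
  rw [re_latticeFT hJ]
  refine tsum_congr fun y => ?_
  simp

/-- **`1 - Ĵ_p(k)` has positive real part on the cube below `p_c`**, given the infrared lower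
bound `c₁|k|²/d ≤ Ĵ_p(0) - Re Ĵ_p(k)`: `Re(1 - Ĵ_p(k)) = (1 - Ĵ_p(0)) + (Ĵ_p(0) - Re Ĵ_p(k)) >
c₁|k|²/d`. [cite: Hara2008, Prop. 1.2 (k-space lower bound) and Appendix A (item 4)] -/
theorem IsLaceCoefficientAt.re_one_sub_latticeFT_pos (h : IsLaceCoefficientAt d p Φ) (hd : 2 ≤ d)
    (hp : p < criticalProbI d) {c₁ : ℝ} {k : Fin d → ℝ}
    (hlow : c₁ * (∑ i, k i ^ 2) / d ≤
      (∑' y, laceKernel p Φ y) - (latticeFT (laceKernel p Φ) k).re) :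
    c₁ * (∑ i, k i ^ 2) / d < (1 - latticeFT (laceKernel p Φ) k).re := by
  have h1 := h.tsum_laceKernel_lt_one hd hp
  simp only [Complex.sub_re, Complex.one_re]
  linarith

/-- Hence `1 - Ĵ_p(k) ≠ 0` on the cube below `p_c`. [cite: Hara2008, Appendix A (item 4)] -/
theorem IsLaceCoefficientAt.one_sub_latticeFT_ne_zero (h : IsLaceCoefficientAt d p Φ) (hd : 2 ≤ d)
    (hp : p < criticalProbI d) {c₁ : ℝ} (hc₁ : 0 < c₁) {k : Fin d → ℝ}
    (hlow : c₁ * (∑ i, k i ^ 2) / d ≤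
      (∑' y, laceKernel p Φ y) - (latticeFT (laceKernel p Φ) k).re) :
    (1 : ℂ) - latticeFT (laceKernel p Φ) k ≠ 0 := by
  have hpos := h.re_one_sub_latticeFT_pos hd hp hlow
  have hd0 : (0 : ℝ) ≤ d := Nat.cast_nonneg d
  have h0 : 0 ≤ c₁ * (∑ i, k i ^ 2) / d :=
    div_nonneg (mul_nonneg hc₁.le (Finset.sum_nonneg fun i _ => sq_nonneg (k i))) hd0
  intro hz
  have := congrArg Complex.re hz
  rw [Complex.zero_re] at this
  linarith

/-- **(6.1.3) below `p_c`**: `τ̂_p(k) = ĝ_p(k)/(1 - Ĵ_p(k))` wherever `1 - Ĵ_p(k) ≠ 0`.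
[cite: HeydenreichVanDerHofstad2017, (6.1.3) and Cor. 8.13 ((8.5.1))] -/
theorem IsLaceCoefficientAt.latticeFT_tau_eq_div (h : IsLaceCoefficientAt d p Φ) (hd : 2 ≤ d)
    (hp : p < criticalProbI d) {k : Fin d → ℝ} (hk : (1 : ℂ) - latticeFT (laceKernel p Φ) k ≠ 0) :
    latticeFT (tau d p 0) k = latticeFT (laceSource Φ) k / (1 - latticeFT (laceKernel p Φ) k) := by
  rw [eq_div_iff hk]
  have e := h.latticeFT_tau_eq hd hp k
  linear_combination e

/-- **Uniqueness of the subcritical coefficient** (Heydenreich–van der Hofstad, Exercise 6.1: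
"(6.1.3) uniquely identifies `Π̂_p(k)`"): for `p < p_c` (`d ≥ 2`), two functions with
`IsLaceCoefficientAt d p Φᵢ` coincide. From `τ̂(1 - Ĵᵢ) = ĝᵢ` and `Ĵᵢ = 2p(Σ_j cos k_j) ĝᵢ` one
gets `ĝᵢ (1 + 2p(Σ_j cos k_j) τ̂) = τ̂`, and the bracket never vanishes (else `τ̂(k) = 0` and the
bracket is `1`); so `ĝ₁ = ĝ₂`, and Fourier inversion gives `g₁ = g₂`.
[cite: HeydenreichVanDerHofstad2017, Exercise 6.1] -/
theorem IsLaceCoefficientAt.unique (hd : 2 ≤ d) (hp : p < criticalProbI d) {Φ₁ Φ₂ : Site d → ℝ}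
    (h₁ : IsLaceCoefficientAt d p Φ₁) (h₂ : IsLaceCoefficientAt d p Φ₂) : Φ₁ = Φ₂ := by
  have hτ := summable_abs_tau_of_lt hd hp
  have hg₁ := summable_abs_laceSource h₁.summable_abs
  have hg₂ := summable_abs_laceSource h₂.summable_abs
  set T : (Fin d → ℝ) → ℂ := latticeFT (tau d p 0) with hT
  have hgeq : ∀ k, latticeFT (laceSource Φ₁) k = latticeFT (laceSource Φ₂) k := by
    intro k
    set c : ℂ := ((2 * (p : ℝ) * ∑ i, Real.cos (k i) : ℝ) : ℂ) with hc
    have e₁ := h₁.latticeFT_tau_eq hd hp k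
    have e₂ := h₂.latticeFT_tau_eq hd hp k
    rw [latticeFT_laceKernel hg₁] at e₁
    rw [latticeFT_laceKernel hg₂] at e₂
    -- `ĝᵢ (1 + c T) = T`
    have f₁ : latticeFT (laceSource Φ₁) k * (1 + c * T k) = T k := by
      rw [hc, hT]; linear_combination -e₁
    have f₂ : latticeFT (laceSource Φ₂) k * (1 + c * T k) = T k := by
      rw [hc, hT]; linear_combination -e₂
    have hne : (1 : ℂ) + c * T k ≠ 0 := by
      intro hz
      have hT0 : T k = 0 := by rw [← f₁, hz, mul_zero]
      rw [hT0, mul_zero, add_zero] at hz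
      exact one_ne_zero hz
    exact mul_right_cancel₀ hne (f₁.trans f₂.symm)
  have hgsub : Summable fun x => |laceSource Φ₁ x - laceSource Φ₂ x| :=
    Summable.of_nonneg_of_le (fun _ => abs_nonneg _) (fun x => abs_sub _ _) (hg₁.add hg₂)
  funext y
  have hinv := integral_cexp_kdot_mul_latticeFT hgsub y
  have hzero : ∫ k in cube d, Complex.exp (Complex.I * (kdot k y : ℂ)) *
      latticeFT (fun x => laceSource Φ₁ x - laceSource Φ₂ x) k = 0 := by
    refine (setIntegral_congr_fun (measurableSet_cube d) fun k _ => ?_).trans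
      (by simp : ∫ k in cube d, (0 : ℂ) = 0)
    rw [latticeFT_sub hg₁ hg₂, hgeq k, sub_self, mul_zero]
  rw [hzero] at hinv
  have hc : ((2 * Real.pi : ℂ)) ^ d ≠ 0 :=
    pow_ne_zero _ (mul_ne_zero two_ne_zero (Complex.ofReal_ne_zero.2 Real.pi_ne_zero))
  have h0 : ((laceSource Φ₁ y - laceSource Φ₂ y : ℝ) : ℂ) = 0 := by
    have := hinv.symm
    rwa [mul_eq_zero, or_iff_right hc] at this
  have h0' : laceSource Φ₁ y - laceSource Φ₂ y = 0 := by exact_mod_cast h0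
  simp only [laceSource] at h0'
  linarith

/-- **Summing the expansion over `x`**: `χ(p)(1 - Ĵ_p(0)) = ĝ_p(0)` below `p_c`, with
`χ(p) = Σ_x τ_p(0,x)` ((6.1.3) at `k = 0`: `χ(p) = (1 + Π̂_p(0))/(1 - 2dp[1 + Π̂_p(0)])`).
[cite: HeydenreichVanDerHofstad2017, (6.1.3) (at k = 0) and (6.1.6)] -/
theorem IsLaceCoefficientAt.chi_mul_one_sub (h : IsLaceCoefficientAt d p Φ) (hd : 2 ≤ d)
    (hp : p < criticalProbI d) :
    chi d p * (1 - ∑' y, laceKernel p Φ y) = ∑' x, laceSource Φ x := by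
  have hτ := summable_abs_tau_of_lt hd hp
  have hg := summable_abs_laceSource h.summable_abs
  have hgs : Summable (laceSource Φ) := summable_abs_iff.1 hg
  have hJ := summable_abs_laceKernel h.summable_abs (p : ℝ)
  have e : ∀ x, tau d p 0 x = laceSource Φ x + ∑' y, laceKernel p Φ y * tau d p 0 (x - y) := h.conv
  have h1 : ∑' x, tau d p 0 x =
      ∑' x, (laceSource Φ x + ∑' y, laceKernel p Φ y * tau d p 0 (x - y)) := tsum_congr e
  rw [Summable.tsum_add hgs (summable_abs_iff.1 (summable_abs_tsum_mul_sub hJ hτ)), tsum_conv hJ hτ] at h1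
  rw [chi_def]
  linear_combination h1

/-- **Fourier inversion below `p_c` combined with (6.1.3)**: for `p < p_c`,
`∫_{[-π,π]^d} e^{ikx} ĝ_p(k)/(1 - Ĵ_p(k)) dk = (2π)^d τ_p(0,x)` — the representation of Prop. 1.2
(resp. (8.5.1) with Fourier inversion) below `p_c`, derived from the `x`-space expansion.
[cite: Hara2008, Prop. 1.2 (representation of G_p, p < p_c) and Appendix A (item 4)]
[cite: HeydenreichVanDerHofstad2017, (8.5.5) (second equality)] -/
theorem IsLaceCoefficientAt.integral_haraIntegrand_eq (h : IsLaceCoefficientAt d p Φ) (hd : 2 ≤ d)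
    (hp : p < criticalProbI d) {c₁ : ℝ} (hc₁ : 0 < c₁)
    (hlow : ∀ k ∈ cube d, c₁ * (∑ i, k i ^ 2) / d ≤
      (∑' y, laceKernel p Φ y) - (latticeFT (laceKernel p Φ) k).re) (x : Site d) :
    ∫ k in cube d, haraIntegrand (laceKernel p Φ) (laceSource Φ) x k =
      ((2 * Real.pi) ^ d : ℂ) * ((tau d p 0 x : ℝ) : ℂ) := by
  rw [← integral_cexp_kdot_mul_latticeFT (summable_abs_tau_of_lt hd hp) x]
  refine setIntegral_congr_fun (measurableSet_cube d) fun k hk => ?_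
  simp only [haraIntegrand]
  rw [h.latticeFT_tau_eq_div hd hp (h.one_sub_latticeFT_ne_zero hd hp hc₁ (hlow k hk))]

/-- **The uniform domination** (Hara, Appendix A item 4: "the integrand is integrable in `k`
uniformly in `p < p_c`, thanks to the infrared bound"): on the cube off the origin,
`‖ĝ_p(k)/(1 - Ĵ_p(k))‖ ≤ B d/(c₁|k|²)` whenever `Σ_x |g_p(x)| ≤ B`.
[cite: Hara2008, Appendix A (item 4)] -/
theorem IsLaceCoefficientAt.norm_ratio_le (h : IsLaceCoefficientAt d p Φ) (hd : 2 ≤ d)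
    (hp : p < criticalProbI d) {c₁ : ℝ} (hc₁ : 0 < c₁) {k : Fin d → ℝ}
    (hlow : c₁ * (∑ i, k i ^ 2) / d ≤
      (∑' y, laceKernel p Φ y) - (latticeFT (laceKernel p Φ) k).re)
    (hk0 : k ≠ 0) {B : ℝ} (hB : ∑' x, |laceSource Φ x| ≤ B) :
    ‖latticeFT (laceSource Φ) k / (1 - latticeFT (laceKernel p Φ) k)‖ ≤
      B * d / (c₁ * ∑ i, k i ^ 2) := by
  have hg := summable_abs_laceSource h.summable_abs
  have hS : 0 < ∑ i, k i ^ 2 := by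
    obtain ⟨j, hj⟩ : ∃ j, k j ≠ 0 := by
      by_contra hne
      push Not at hne
      exact hk0 (funext hne)
    exact lt_of_lt_of_le (by positivity) (Finset.single_le_sum (fun i _ => sq_nonneg (k i))
      (Finset.mem_univ j))
  have hd' : (0 : ℝ) < d := by exact_mod_cast (show 0 < d by omega)
  have hre := h.re_one_sub_latticeFT_pos hd hp hlow
  have hlowpos : 0 < c₁ * (∑ i, k i ^ 2) / d := by positivity
  have hden : c₁ * (∑ i, k i ^ 2) / d ≤ ‖(1 : ℂ) - latticeFT (laceKernel p Φ) k‖ :=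
    hre.le.trans ((le_abs_self _).trans (Complex.abs_re_le_norm _))
  have hdenpos : 0 < ‖(1 : ℂ) - latticeFT (laceKernel p Φ) k‖ := lt_of_lt_of_le hlowpos hden
  rw [norm_div, div_le_div_iff₀ hdenpos (by positivity)]
  have hnum : ‖latticeFT (laceSource Φ) k‖ ≤ B := (norm_latticeFT_le hg k).trans hB
  have hB0 : 0 ≤ B := le_trans (tsum_nonneg fun _ => abs_nonneg _) hB
  calc ‖latticeFT (laceSource Φ) k‖ * (c₁ * ∑ i, k i ^ 2)
      = (‖latticeFT (laceSource Φ) k‖ * d) * (c₁ * (∑ i, k i ^ 2) / d) := by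
        field_simp
    _ ≤ (B * d) * ‖(1 : ℂ) - latticeFT (laceKernel p Φ) k‖ := by
        gcongr

end Subcrit

/-! ### Two facts about the cube: `S(k) > 0` off the origin and `∫ S^{-1} < ∞` (`d ≥ 7`) -/

/-- `S(k) = Σ_j (1 - cos k_j) > 0` for `k ∈ [-π,π]^d ∖ {0}`. [folklore] -/
theorem S_pos_of_ne_zero {k : Fin d → ℝ} (hk : k ∈ cube d) (hk0 : k ≠ 0) : 0 < S d k := by
  by_contra hle
  have hle' : S d k ≤ 0 := not_lt.1 hle
  have h0 : S d k = 0 := le_antisymm hle' (S_nonneg d k)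
  have hterm : ∀ j ∈ Finset.univ, 1 - Real.cos (k j) = 0 :=
    (Finset.sum_eq_zero_iff_of_nonneg fun j _ => sub_nonneg.2 (Real.cos_le_one (k j))).1 h0
  apply hk0
  funext j
  have hj := hk j (Set.mem_univ j)
  rw [Set.mem_Icc] at hj
  have hcos : Real.cos (k j) = 1 := by linarith [hterm j (Finset.mem_univ j)]
  exact (Real.cos_eq_one_iff_of_lt_of_lt (by linarith [Real.pi_pos]) (by linarith [Real.pi_pos])).1 hcos

/-- `S ≤ 2d`. [folklore] -/
theorem S_le_two_mul (k : Fin d → ℝ) : S d k ≤ 2 * d := by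
  unfold S
  calc ∑ j, (1 - Real.cos (k j)) ≤ ∑ _j : Fin d, (2 : ℝ) :=
        Finset.sum_le_sum fun j _ => by linarith [Real.neg_one_le_cos (k j)]
    _ = 2 * d := by simp [mul_comm]

/-- **`∫_{[-π,π]^d} S(k)^{-1} dk < ∞` for `d ≥ 7`** (indeed for `d ≥ 3`; here from the case of
`S^{-3}` via `S^{-1} = S² S^{-3} ≤ (2d)² S^{-3}`): the integrable singularity "for `k = 0` when
`d > 2`" of (8.5.4). [cite: HeydenreichVanDerHofstad2017, Cor. 8.13 (proof: "integrable singularity for k = 0 when d > 2")] -/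
theorem integrable_inv_S (hd : 7 ≤ d) : Integrable (fun k => (S d k)⁻¹) (P d) := by
  refine Integrable.mono' ((integrable_inv_S_pow_three hd).const_mul ((2 * d : ℝ) ^ 2))
    (continuous_S d).measurable.inv.aestronglyMeasurable (ae_of_all _ fun k => ?_)
  rw [Real.norm_eq_abs, abs_of_nonneg (inv_nonneg.2 (S_nonneg d k))]
  rcases (S_nonneg d k).eq_or_lt with h0 | hpos
  · rw [← h0]; simp
  · have h2d := S_le_two_mul k
    have e : (S d k)⁻¹ = (S d k) ^ 2 * ((S d k)⁻¹ ^ 3) := by field_simp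
    calc (S d k)⁻¹ = (S d k) ^ 2 * ((S d k)⁻¹ ^ 3) := e
      _ ≤ (2 * d : ℝ) ^ 2 * ((S d k)⁻¹ ^ 3) := by
          gcongr

/-! ### The passage `p ↑ p_c` (Hara, Appendix A; Heydenreich–van der Hofstad, proof of Cor. 8.13) -/

section Limit

variable {Φ : unitInterval → Site d → ℝ} {Ψ : Site d → ℝ} {h : Site d → ℝ}

/-- The majorant `h'(z) = δ_{0,z} + h(z)` of `|g_p(z)| = |δ_{0,z} + Π_p(z)|`. [folklore] -/
theorem abs_laceSource_le_of_le {Φ₀ : Site d → ℝ} (hle : ∀ x, |Φ₀ x| ≤ h x) (z : Site d) :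
    |laceSource Φ₀ z| ≤ (if z = 0 then (1 : ℝ) else 0) + h z := by
  unfold laceSource
  refine (abs_add_le _ _).trans (add_le_add ?_ (hle z))
  split_ifs <;> simp

/-- The majorant `Σ_i (h'(y + eᵢ) + h'(y - eᵢ))` of `|J_p(y)|` (`|p| ≤ 1`). [folklore] -/
theorem abs_laceKernel_le_of_le {Φ₀ : Site d → ℝ} (hle : ∀ x, |Φ₀ x| ≤ h x) (p : unitInterval)
    (y : Site d) :
    |laceKernel p Φ₀ y| ≤ ∑ i : Fin d,
      (((if y + Pi.single i 1 = 0 then (1 : ℝ) else 0) + h (y + Pi.single i 1)) +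
        ((if y - Pi.single i 1 = 0 then (1 : ℝ) else 0) + h (y - Pi.single i 1))) := by
  have hb := abs_laceSource_le_of_le hle
  unfold laceKernel
  rw [abs_mul]
  have hp1 : |(p : ℝ)| ≤ 1 := by rw [abs_of_nonneg p.2.1]; exact p.2.2
  calc |(p : ℝ)| * |∑ i, (laceSource Φ₀ (y + Pi.single i 1) + laceSource Φ₀ (y - Pi.single i 1))|
      ≤ 1 * ∑ i, (((if y + Pi.single i 1 = 0 then (1 : ℝ) else 0) + h (y + Pi.single i 1)) +
          ((if y - Pi.single i 1 = 0 then (1 : ℝ) else 0) + h (y - Pi.single i 1))) := by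
        refine mul_le_mul hp1 ?_ (abs_nonneg _) zero_le_one
        refine (Finset.abs_sum_le_sum_abs _ _).trans (Finset.sum_le_sum fun i _ => ?_)
        exact (abs_add_le _ _).trans (add_le_add (hb _) (hb _))
    _ = _ := one_mul _

/-- The majorant of `|g_p|` is summable. [folklore] -/
theorem summable_sourceBound (hh : Summable h) :
    Summable fun z : Site d => (if z = 0 then (1 : ℝ) else 0) + h z := by
  refine Summable.add ?_ hh
  exact summable_of_ne_finset_zero (s := {0}) fun z hz => by
    rw [Finset.mem_singleton] at hz
    rw [if_neg hz]

/-- The majorant of `|J_p|` is summable. [folklore] -/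
theorem summable_kernelBound (hh : Summable h) :
    Summable fun y : Site d => ∑ i : Fin d,
      (((if y + Pi.single i 1 = 0 then (1 : ℝ) else 0) + h (y + Pi.single i 1)) +
        ((if y - Pi.single i 1 = 0 then (1 : ℝ) else 0) + h (y - Pi.single i 1))) := by
  have hs := summable_sourceBound hh
  refine summable_sum fun i _ => ?_
  exact (summable_comp_add_right hs _).add (summable_comp_sub_right hs _)

/-- `(p : ℝ) → p_c` along `p ↑ p_c`. [folklore] -/
theorem tendsto_coe_nhdsLT_criticalProbI :
    Tendsto (fun p : unitInterval => (p : ℝ)) (𝓝[<] criticalProbI d) (𝓝 (criticalProbI d : ℝ)) :=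
  (continuous_subtype_val.tendsto (criticalProbI d)).mono_left nhdsWithin_le_nhds

/-- Pointwise convergence of the sources: `g_p(x) → g(x)`. [folklore] -/
theorem tendsto_laceSource_apply
    (hlim : ∀ x, Tendsto (fun p : unitInterval => Φ p x) (𝓝[<] criticalProbI d) (𝓝 (Ψ x)))
    (x : Site d) :
    Tendsto (fun p : unitInterval => laceSource (Φ p) x) (𝓝[<] criticalProbI d)
      (𝓝 (laceSource Ψ x)) :=
  tendsto_const_nhds.add (hlim x)

/-- Pointwise convergence of the kernels: `J_p(y) → J(y) = (2dp_c D ⋆ g)(y)`. [folklore] -/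
theorem tendsto_laceKernel_apply
    (hlim : ∀ x, Tendsto (fun p : unitInterval => Φ p x) (𝓝[<] criticalProbI d) (𝓝 (Ψ x)))
    (y : Site d) :
    Tendsto (fun p : unitInterval => laceKernel p (Φ p) y) (𝓝[<] criticalProbI d)
      (𝓝 (laceKernel (criticalProbI d) Ψ y)) := by
  unfold laceKernel
  refine tendsto_coe_nhdsLT_criticalProbI.mul (tendsto_finsetSum _ fun i _ => ?_)
  exact (tendsto_laceSource_apply hlim _).add (tendsto_laceSource_apply hlim _)

/-- **`Ĵ_p(0) = Σ_y J_p(y) → Σ_y J(y)`** as `p ↑ p_c` (dominated convergence for series, with the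
`p`-independent majorant of Prop. 1.2). [cite: Hara2008, Appendix A (items 1–3)] -/
theorem tendsto_tsum_laceKernel (hh : Summable h)
    (hle : ∀ p : unitInterval, p < criticalProbI d → ∀ x, |Φ p x| ≤ h x)
    (hlim : ∀ x, Tendsto (fun p : unitInterval => Φ p x) (𝓝[<] criticalProbI d) (𝓝 (Ψ x))) :
    Tendsto (fun p : unitInterval => ∑' y, laceKernel p (Φ p) y) (𝓝[<] criticalProbI d)
      (𝓝 (∑' y, laceKernel (criticalProbI d) Ψ y)) := by
  refine tendsto_tsum_of_dominated_convergence (summable_kernelBound hh)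
    (tendsto_laceKernel_apply hlim) ?_
  refine eventually_nhdsWithin_of_forall fun p hp y => ?_
  rw [Real.norm_eq_abs]
  exact abs_laceKernel_le_of_le (hle p hp) p y

/-- **`Ĵ_p(k) → Ĵ(k)`** as `p ↑ p_c`, for every `k` ("`Π̂_p(k)` converges to `Π̂_{p_c}(k)` as
`p ↗ p_c`"). [cite: HeydenreichVanDerHofstad2017, Cor. 8.13 (proof)] [cite: Hara2008, Appendix A (item 3)] -/
theorem tendsto_latticeFT_laceKernel (hh : Summable h)
    (hle : ∀ p : unitInterval, p < criticalProbI d → ∀ x, |Φ p x| ≤ h x)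
    (hlim : ∀ x, Tendsto (fun p : unitInterval => Φ p x) (𝓝[<] criticalProbI d) (𝓝 (Ψ x)))
    (k : Fin d → ℝ) :
    Tendsto (fun p : unitInterval => latticeFT (laceKernel p (Φ p)) k) (𝓝[<] criticalProbI d)
      (𝓝 (latticeFT (laceKernel (criticalProbI d) Ψ) k)) := by
  unfold latticeFT
  refine tendsto_tsum_of_dominated_convergence (summable_kernelBound hh) (fun y => ?_) ?_
  · exact ((Complex.continuous_ofReal.tendsto _).comp (tendsto_laceKernel_apply hlim y)).mul
      tendsto_const_nhds
  · refine eventually_nhdsWithin_of_forall fun p hp y => ?_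
    rw [norm_latticeFT_term]
    exact abs_laceKernel_le_of_le (hle p hp) p y

/-- **`ĝ_p(k) → ĝ(k)`** as `p ↑ p_c`, for every `k`.
[cite: HeydenreichVanDerHofstad2017, Cor. 8.13 (proof)] [cite: Hara2008, Appendix A (item 3)] -/
theorem tendsto_latticeFT_laceSource (hh : Summable h)
    (hle : ∀ p : unitInterval, p < criticalProbI d → ∀ x, |Φ p x| ≤ h x)
    (hlim : ∀ x, Tendsto (fun p : unitInterval => Φ p x) (𝓝[<] criticalProbI d) (𝓝 (Ψ x)))
    (k : Fin d → ℝ) :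
    Tendsto (fun p : unitInterval => latticeFT (laceSource (Φ p)) k) (𝓝[<] criticalProbI d)
      (𝓝 (latticeFT (laceSource Ψ) k)) := by
  unfold latticeFT
  refine tendsto_tsum_of_dominated_convergence (summable_sourceBound hh) (fun y => ?_) ?_
  · exact ((Complex.continuous_ofReal.tendsto _).comp (tendsto_laceSource_apply hlim y)).mul
      tendsto_const_nhds
  · refine eventually_nhdsWithin_of_forall fun p hp y => ?_
    rw [norm_latticeFT_term]
    exact abs_laceSource_le_of_le (hle p hp) y

/-- **(A.1) derived: `Ĵ_p(0) → 1` as `p ↑ p_c`** ("the critical point is characterized by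
`lim_{p↑p_c} Ĵ_p(0) = 1`"): `|1 - Ĵ_p(0)| = |ĝ_p(0)|/χ(p) ≤ (1 + Σh) · 2d(p_c - p) → 0` by
`χ(p)(1 - Ĵ_p(0)) = ĝ_p(0)` and the mean-field bound `χ(p) ≥ 1/(2d(p_c - p))`
(`AizenmanNewman1984_chi_lower_holds`). [cite: Hara2008, Appendix A ((A.1))]
[cite: HeydenreichVanDerHofstad2017, (6.1.6) ("χ(p) → ∞ as p ↗ p_c")] -/
theorem tendsto_tsum_laceKernel_one (hd : 2 ≤ d) (hh : Summable h)
    (hAt : ∀ p : unitInterval, p < criticalProbI d → IsLaceCoefficientAt d p (Φ p))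
    (hle : ∀ p : unitInterval, p < criticalProbI d → ∀ x, |Φ p x| ≤ h x) :
    Tendsto (fun p : unitInterval => ∑' y, laceKernel p (Φ p) y) (𝓝[<] criticalProbI d) (𝓝 1) := by
  set pc := criticalProbI d with hpc_def
  set B : ℝ := (∑' z : Site d, ((if z = 0 then (1 : ℝ) else 0) + h z)) with hB
  have hd' : (0 : ℝ) < d := by exact_mod_cast (show 0 < d by omega)
  -- the bound `|1 - Ĵ_p(0)| ≤ B · 2d · (p_c - p)` for `p < p_c`
  have key : ∀ p : unitInterval, p < pc →
      |(∑' y, laceKernel p (Φ p) y) - 1| ≤ B * (2 * d) * ((pc : ℝ) - p) := by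
    intro p hp
    have hp' : (p : ℝ) < criticalProb (zdGraph d) 0 := hp
    have hχ := (hAt p hp).chi_mul_one_sub hd hp
    have hχ1 : 1 ≤ chi d p := one_le_chi hd p hp'
    have hχpos : 0 < chi d p := by linarith
    have hAN := AizenmanNewman1984_chi_lower_holds d hd p hp'
    have hgap : 0 < criticalProb (zdGraph d) (0 : Site d) - p := by linarith
    have hG0 : |∑' x, laceSource (Φ p) x| ≤ B := by
      have hs := summable_abs_laceSource (hAt p hp).summable_abs
      calc |∑' x, laceSource (Φ p) x| ≤ ∑' x, |laceSource (Φ p) x| := by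
            rw [← Real.norm_eq_abs]
            exact norm_tsum_le_tsum_norm (by simpa [Real.norm_eq_abs] using hs)
        _ ≤ B := Summable.tsum_le_tsum (abs_laceSource_le_of_le (hle p hp)) hs
            (summable_sourceBound hh)
    have e1 : |(∑' y, laceKernel p (Φ p) y) - 1| = |∑' x, laceSource (Φ p) x| / chi d p := by
      rw [eq_div_iff hχpos.ne', ← hχ, abs_mul, abs_of_pos hχpos, abs_sub_comm]
      ring
    rw [e1, div_le_iff₀ hχpos]
    have h2 : 1 ≤ 2 * d * (criticalProb (zdGraph d) (0 : Site d) - p) * chi d p := by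
      rw [div_le_iff₀ (by positivity)] at hAN
      linarith
    have hB0 : 0 ≤ B := le_trans (abs_nonneg _) hG0
    calc |∑' x, laceSource (Φ p) x| ≤ B * 1 := by rw [mul_one]; exact hG0
      _ ≤ B * (2 * d * (criticalProb (zdGraph d) (0 : Site d) - p) * chi d p) :=
          mul_le_mul_of_nonneg_left h2 hB0
      _ = B * (2 * d) * ((pc : ℝ) - p) * chi d p := by rw [hpc_def, coe_criticalProbI]; ring
  -- squeeze
  have hgap : Tendsto (fun p : unitInterval => B * (2 * d) * ((pc : ℝ) - p)) (𝓝[<] pc) (𝓝 0) := by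
    have h1 : Tendsto (fun p : unitInterval => B * (2 * d) * ((pc : ℝ) - p)) (𝓝[<] pc)
        (𝓝 (B * (2 * d) * ((pc : ℝ) - pc))) :=
      tendsto_const_nhds.mul (tendsto_const_nhds.sub tendsto_coe_nhdsLT_criticalProbI)
    rwa [sub_self, mul_zero] at h1
  have hev : ∀ᶠ p : unitInterval in 𝓝[<] pc, |(∑' y, laceKernel p (Φ p) y) - 1| ≤
      B * (2 * d) * ((pc : ℝ) - p) := eventually_nhdsWithin_of_forall key
  have h0 : Tendsto (fun p : unitInterval => (∑' y, laceKernel p (Φ p) y) - 1) (𝓝[<] pc) (𝓝 0) :=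
    squeeze_zero_norm' (by simpa only [Real.norm_eq_abs] using hev) hgap
  have := h0.add_const 1
  simpa using this

end Limit



/-! ### Assembly: `Hara2008_prop12Pc` from the subcritical expansion and the left limit -/

/-- **Hara's Appendix A (items 1–4), proved**: the subcritical lace expansion with `p`-uniform
bounds (`Hara2008_prop12Subcrit`) and the existence of the left limits `Π_{p_c}(x) :=
lim_{p↑p_c} Π_p(x)` (`Hara2008_piLeftLimit`) give the `k`-space half `Hara2008_prop12Pc` at
`p = p_c`: `Π_{p_c}` is symmetric and dominated by `h` (items 1–2); `Σ|x|²|Π_{p_c}| ≤ C` by Fatou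
on finite sums; `Ĵ_p(k) → Ĵ_{p_c}(k)` by dominated convergence for series (item 3), so
`Ĵ_{p_c}(0) = lim Ĵ_p(0) = 1` ((A.1), here derived from `χ(p) ≥ 1/(2d(p_c - p))`) and the
infrared lower bound passes to the limit; and (item 4) `G_{p_c}(x) = lim G_p(x) =
lim ∫ e^{ikx} ĝ_p/(1 - Ĵ_p) = ∫ e^{ikx} ĝ_{p_c}/(1 - Ĵ_{p_c})` by the left-continuity of `τ_p`
(`tendsto_tau_nhdsLT_criticalProbI`) and dominated convergence on the cube with the majorant
`const · S(k)^{-1}` ("the integrand is integrable in `k` uniformly in `p < p_c`, thanks to the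
infrared bound (recall that we are considering `d > 2`)").
[cite: Hara2008, Appendix A (items 1–4 and (A.2))]
[cite: HeydenreichVanDerHofstad2017, Cor. 8.13 (proof, (8.5.4)–(8.5.5))] -/
theorem Hara2008_prop12Pc_of_subcrit (hS : Hara2008_prop12Subcrit) (hL : Hara2008_piLeftLimit) :
    Hara2008_prop12Pc := by
  intro d hd
  obtain ⟨Φ, h, c₁, C, p₀, hh, hc₁, hp₀, hP, hIR⟩ := hS d hd
  have hd2 : 2 ≤ d := by omega
  have hd1 : 1 ≤ d := by omega
  have hd7 : 7 ≤ d := by omega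
  have hd' : (0 : ℝ) < d := by exact_mod_cast (show 0 < d by omega)
  set pc := criticalProbI d with hpc_def
  have hpc0 : 0 < criticalProb (zdGraph d) (0 : Site d) := criticalProb_zd_pos d hd1
  haveI hne : (𝓝[<] pc).NeBot :=
    nhdsLT_neBot_of_exists_lt ⟨0, show (0 : unitInterval) < pc by exact_mod_cast hpc0⟩
  have hAt : ∀ p, p < pc → IsLaceCoefficientAt d p (Φ p) := fun p hp => (hP p hp).1
  have hle : ∀ p, p < pc → ∀ x, |Φ p x| ≤ h x := fun p hp => (hP p hp).2.1
  have hmom : ∀ p, p < pc → Summable fun x => euclidNorm x ^ 2 * |Φ p x| :=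
    fun p hp => (hP p hp).2.2.1
  have hmomC : ∀ p, p < pc → ∑' x, euclidNorm x ^ 2 * |Φ p x| ≤ C :=
    fun p hp => (hP p hp).2.2.2
  have hlow : ∀ p, p₀ ≤ p → p < pc → ∀ k ∈ cube d, c₁ * (∑ i, k i ^ 2) / d ≤
      (∑' y, laceKernel p (Φ p) y) - (latticeFT (laceKernel p (Φ p)) k).re := hIR
  -- the left limit `Ψ = Π_{p_c}`
  choose Ψ hΨ using hL d hd Φ hAt
  have hev : ∀ᶠ p : unitInterval in 𝓝[<] pc, p < pc := eventually_mem_nhdsWithin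
  -- eventually `p ∈ [p₀, p_c)`, where the infrared lower bound is available
  have hev' : ∀ᶠ p : unitInterval in 𝓝[<] pc, p₀ ≤ p ∧ p < pc := by
    filter_upwards [Ico_mem_nhdsLT hp₀] with p hp
    exact ⟨hp.1, hp.2⟩
  -- (1) symmetry
  have hsymm : IsZdSymmetric Ψ := by
    intro π ε x
    have h2 : (fun p : unitInterval => Φ p x) =ᶠ[𝓝[<] pc] fun p => Φ p (Site.signedPerm π ε x) :=
      hev.mono fun p hp => ((hAt p hp).symm π ε x).symm
    exact tendsto_nhds_unique ((hΨ x).congr' h2) (hΨ _) |>.symm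
  -- (2) domination and summability
  have hΨle : ∀ x, |Ψ x| ≤ h x := fun x =>
    le_of_tendsto ((continuous_abs.tendsto _).comp (hΨ x)) (hev.mono fun p hp => hle p hp x)
  have hΨabs : Summable fun x => |Ψ x| :=
    Summable.of_nonneg_of_le (fun _ => abs_nonneg _) hΨle hh
  -- (3) the second moment, by Fatou on finite sums
  have hΨmom : Summable fun x => euclidNorm x ^ 2 * |Ψ x| := by
    refine summable_of_sum_le (fun x => by positivity) (c := C) fun F => ?_
    have hT : Tendsto (fun p : unitInterval => ∑ x ∈ F, euclidNorm x ^ 2 * |Φ p x|) (𝓝[<] pc)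
        (𝓝 (∑ x ∈ F, euclidNorm x ^ 2 * |Ψ x|)) :=
      tendsto_finsetSum F fun x _ => ((continuous_abs.tendsto _).comp (hΨ x)).const_mul _
    refine le_of_tendsto hT (hev.mono fun p hp => ?_)
    exact (Summable.sum_le_tsum F (fun x _ => by positivity) (hmom p hp)).trans (hmomC p hp)
  -- (4) `Ĵ_{p_c}(0) = 1`
  have hJlim := tendsto_tsum_laceKernel hh hle hΨ
  have hJone := tendsto_tsum_laceKernel_one hd2 hh hAt hle
  have hsumJ : ∑' y, laceKernel pc Ψ y = 1 := tendsto_nhds_unique hJlim hJone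
  have hJsum : Summable (laceKernel pc Ψ) :=
    summable_abs_iff.1 (summable_abs_laceKernel hΨabs _)
  have hHasSum : HasSum (laceKernel pc Ψ) 1 := hsumJ ▸ hJsum.hasSum
  -- (5) the infrared lower bound at `p_c`
  have hlowc : ∀ k ∈ cube d, c₁ * (∑ i, k i ^ 2) / d ≤ 1 - (latticeFT (laceKernel pc Ψ) k).re := by
    intro k hk
    have hT : Tendsto (fun p : unitInterval =>
        (∑' y, laceKernel p (Φ p) y) - (latticeFT (laceKernel p (Φ p)) k).re) (𝓝[<] pc)
        (𝓝 (1 - (latticeFT (laceKernel pc Ψ) k).re)) :=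
      hJone.sub ((Complex.continuous_re.tendsto _).comp (tendsto_latticeFT_laceKernel hh hle hΨ k))
    exact ge_of_tendsto hT (hev'.mono fun p hp => hlow p hp.1 hp.2 k hk)
  have hden : ∀ k ∈ cube d, k ≠ 0 → (1 : ℂ) - latticeFT (laceKernel pc Ψ) k ≠ 0 := by
    intro k hk hk0
    have hS : 0 < ∑ i, k i ^ 2 := by
      obtain ⟨j, hj⟩ : ∃ j, k j ≠ 0 := by
        by_contra hne'
        push Not at hne'
        exact hk0 (funext hne')
      exact lt_of_lt_of_le (by positivity) (Finset.single_le_sum (fun i _ => sq_nonneg (k i))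
        (Finset.mem_univ j))
    have hpos : 0 < 1 - (latticeFT (laceKernel pc Ψ) k).re :=
      lt_of_lt_of_le (by positivity) (hlowc k hk)
    intro hz
    have := congrArg Complex.re hz
    simp only [Complex.sub_re, Complex.one_re, Complex.zero_re] at this
    linarith
  -- (6) the representation at `p_c`, by dominated convergence on the cube
  have hrepr : ∀ x : Site d,
      ((tau d pc 0 x : ℝ) : ℂ) = haraH (laceKernel pc Ψ) (laceSource Ψ) x := by
    intro x
    set F : unitInterval → (Fin d → ℝ) → ℂ := fun p k =>
      haraIntegrand (laceKernel p (Φ p)) (laceSource (Φ p)) x k with hF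
    set Fc : (Fin d → ℝ) → ℂ := fun k =>
      haraIntegrand (laceKernel pc Ψ) (laceSource Ψ) x k with hFc
    set B : ℝ := ∑' z : Site d, ((if z = 0 then (1 : ℝ) else 0) + h z) with hB
    set bound : (Fin d → ℝ) → ℝ := fun k => B * d / (c₁ * 2) * (S d k)⁻¹ with hbound
    have hPd : (volume.restrict (cube d) : Measure (Fin d → ℝ)) = P d := volume_restrict_cube d
    have hae : ∀ᵐ k ∂P d, k ∈ cube d ∧ k ≠ 0 := by
      have h1 : ∀ᵐ k ∂P d, k ∈ cube d := by
        rw [← hPd]; exact ae_restrict_mem (measurableSet_cube d)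
      have h2 : ∀ᵐ k ∂P d, k ∈ ({0} : Set (Fin d → ℝ))ᶜ :=
        compl_mem_ae_iff.2 (P_singleton_zero hd1)
      filter_upwards [h1, h2] with k hk hk0
      exact ⟨hk, hk0⟩
    -- measurability (for `p < p_c`, `F p` is a.e. the continuous function `e^{ikx} τ̂_p(k)`)
    have hmeas : ∀ᶠ p : unitInterval in 𝓝[<] pc, AEStronglyMeasurable (F p) (P d) := by
      refine hev'.mono fun p hp => ?_
      have hcont : Continuous fun k =>
          Complex.exp (Complex.I * (kdot k x : ℂ)) * latticeFT (tau d p 0) k :=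
        (continuous_cexp_I_mul_kdot x).mul (continuous_latticeFT (summable_abs_tau_of_lt hd2 hp.2))
      refine hcont.aestronglyMeasurable.congr ?_
      filter_upwards [hae] with k hk
      simp only [hF, haraIntegrand]
      rw [(hAt p hp.2).latticeFT_tau_eq_div hd2 hp.2
        ((hAt p hp.2).one_sub_latticeFT_ne_zero hd2 hp.2 hc₁ (hlow p hp.1 hp.2 k hk.1))]
    -- domination by `bound`
    have hdom : ∀ᶠ p : unitInterval in 𝓝[<] pc, ∀ᵐ k ∂P d, ‖F p k‖ ≤ bound k := by
      refine hev'.mono fun p hp => ?_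
      filter_upwards [hae] with k hk
      have hBp : ∑' z, |laceSource (Φ p) z| ≤ B :=
        Summable.tsum_le_tsum (abs_laceSource_le_of_le (hle p hp.2))
          (summable_abs_laceSource (hAt p hp.2).summable_abs) (summable_sourceBound hh)
      have h1 := (hAt p hp.2).norm_ratio_le hd2 hp.2 hc₁ (hlow p hp.1 hp.2 k hk.1) hk.2 hBp
      have hSpos := S_pos_of_ne_zero hk.1 hk.2
      have h2S := two_mul_S_le_sum_sq k
      have hB0 : 0 ≤ B := le_trans (tsum_nonneg fun _ => abs_nonneg _) hBp
      simp only [hF, haraIntegrand, norm_mul, norm_cexp_I_mul_kdot, one_mul]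
      refine h1.trans ?_
      have e : bound k = B * d / (c₁ * (2 * S d k)) := by
        rw [hbound]
        field_simp
      rw [e]
      exact div_le_div_of_nonneg_left (by positivity) (by positivity) (by nlinarith)
    have hbi : Integrable bound (P d) := (integrable_inv_S hd7).const_mul _
    -- pointwise limit
    have hlimF : ∀ᵐ k ∂P d, Tendsto (fun p => F p k) (𝓝[<] pc) (𝓝 (Fc k)) := by
      filter_upwards [hae] with k hk
      simp only [hF, hFc, haraIntegrand]
      exact tendsto_const_nhds.mul ((tendsto_latticeFT_laceSource hh hle hΨ k).div
        (tendsto_const_nhds.sub (tendsto_latticeFT_laceKernel hh hle hΨ k)) (hden k hk.1 hk.2))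
    have hDCT := tendsto_integral_filter_of_dominated_convergence bound hmeas hdom hbi hlimF
    -- the integrals below `p_c` are `(2π)^d τ_p(x)`, which converge to `(2π)^d τ_{p_c}(x)`
    have hFint : ∀ᶠ p : unitInterval in 𝓝[<] pc,
        ((2 * Real.pi) ^ d : ℂ) * ((tau d p 0 x : ℝ) : ℂ) = ∫ k, F p k ∂P d :=
      hev'.mono fun p hp => by
        rw [← hPd]
        exact ((hAt p hp.2).integral_haraIntegrand_eq hd2 hp.2 hc₁ (hlow p hp.1 hp.2) x).symm
    have hτlim : Tendsto (fun p : unitInterval => ((2 * Real.pi) ^ d : ℂ) * ((tau d p 0 x : ℝ) : ℂ))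
        (𝓝[<] pc) (𝓝 (((2 * Real.pi) ^ d : ℂ) * ((tau d pc 0 x : ℝ) : ℂ))) :=
      tendsto_const_nhds.mul ((Complex.continuous_ofReal.tendsto _).comp
        (tendsto_tau_nhdsLT_criticalProbI x))
    have heq : ∫ k, Fc k ∂P d = ((2 * Real.pi) ^ d : ℂ) * ((tau d pc 0 x : ℝ) : ℂ) :=
      tendsto_nhds_unique hDCT (hτlim.congr' hFint)
    have hc : ((2 * Real.pi : ℂ)) ^ d ≠ 0 :=
      pow_ne_zero _ (mul_ne_zero two_ne_zero (Complex.ofReal_ne_zero.2 Real.pi_ne_zero))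
    unfold haraH
    rw [hPd]
    change _ = (∫ k, Fc k ∂P d) / _
    rw [heq, mul_div_cancel_left₀ _ hc]
  exact ⟨Ψ, ⟨hsymm, hΨabs, hHasSum, ⟨c₁, hc₁, hlowc⟩, hrepr⟩, hΨmom⟩

/-- **`Hara2008_laceExpansionPc` from the printed `k`-space inputs and the `x`-space half.**
[cite: Hara2008, §1.2.1 and Appendix A] -/
theorem Hara2008_laceExpansionPc_of_subcrit (hS : Hara2008_prop12Subcrit) (hL : Hara2008_piLeftLimit)
    (hX : Hara2008_xSpacePiBoundPc) : Hara2008_laceExpansionPc :=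
  Hara2008_laceExpansionPc_of_inputs (Hara2008_prop12Pc_of_subcrit hS hL) hX

end Literature.Barriers.CriticalPhenomena
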